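import Mathlib.GroupTheory.QuotientGroup.Defs
import Mathlib.LinearAlgebra.Dimension.Free
import Mathlib.LinearAlgebra.Matrix.Basis
import Mathlib.LinearAlgebra.Matrix.Determinant.Basic
import Mathlib.LinearAlgebra.Matrix.SesquilinearForm
import Mathlib.RingTheory.Norm.Defs
import Literature.AlgebraicGeometry.Motives.WeilTypeCM
import HarnessLib

/-!
# The discriminant `det H ∈ ℚ^× / Nm(K^×)` of a polarized Hodge structure of Weil type

For a polarized abelian variety of Weil type `(X, K, E)` (`dim X = 2n`, `K = ℚ(√-d) ↪ End(X) ⊗ ℚ`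
acting with multiplicities `(n, n)`, `E` a polarization with `(√-d)^* E = d E`; van Geemen, *An
introduction to the Hodge conjecture for abelian varieties*, LNM 1594 (1994), 4.9), van Geemen's
Lemma 5.2 states: `H(x, y) := E(x, (√-d)·y) + √-d · E(x, y)` is a non-degenerate Hermitian form
on the `K`-vector space `H₁(X, ℚ)` (`K`-linear in the second variable, `H(y, x) = conj H(x, y)`) of
signature `(n, n)`, and for its matrix `Ψ ∈ M_{2n}(K)` in a `K`-basis, `det Ψ ∈ ℚ^× / Nm(K^×)`
depends neither on the basis nor on the lattice: an isogeny invariant `det H` of `(X, K, E)`, the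
**discriminant** (Markman, arXiv:2502.03415, §1.1; `(n, K, det H)` indexes the components of the
`n²`-dimensional moduli of Weil-type abelian `2n`-folds up to isogeny).

Contents (pure (semi)linear algebra, three layers):
* `normUnitsSubgroup F K = Nm_{K/F}(Kˣ) ≤ Fˣ` (the norm residue group is
  `Fˣ ⧸ normUnitsSubgroup F K`), `normResidueClass F δ` (class of `δ ∈ K` when `δ ∈ Fˣ`, junk `1`
  otherwise), `gramMatrix B v = (B(vᵢ, vⱼ))`, `discrClass F B` (class of the Gram determinant in the
  basis `Module.finBasis K V`); basis independence for `σ`-sesquilinear `B` with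
  `k · σ k = Nm_{K/F} k`: `gramMatrix_basis_eq_mul` (`Ψ ↦ ᵗ(σP) Ψ P`), `det_gramMatrix_basis`,
  `normResidueClass_det_gramMatrix_eq`, `discrClass_eq_of_basis` (van Geemen's Lemma 5.2 (3)).
* `weilHermitianForm E α x y = E(x, α • y) + α · E(x, y)` (van Geemen's `H`, `α = √-d`) for a
  `ℚ`-bilinear `E` on a `K`-module and `α : K`; `weilDiscriminant E α := discrClass ℚ (H) ∈ ℚˣ⧸Nm`;
  `weilHermitianForm_smul_right` (`K`-linearity in `α`), `weilHermitianForm_swap` (Hermitian),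
  `weilHermitianForm_smul`/`weilDiscriminant_smul` (`α ↦ c α`, `c ∈ ℚ^×`, does not change the
  class when `dim_K V` is even and `[K : ℚ] = 2`).
* For `A : H.EndAction E` (`Motives/WeilTypeCM`: `IsOfWeilType`, `weilClasses`) and
  `Q : H.Polarization` in weight `1`: `A.IsWeilPolarization Q` (`Q(k x, k y) = Nm(k) Q(x, y)`,
  Markman §1.1 = van Geemen 4.9 for `k = √-d`), `A.weilHermitianForm Q α`,
  `A.weilDiscriminant Q α ∈ ℚˣ ⧸ Nm(Eˣ)`.

Design: `K` is an abstract field with `[Algebra ℚ K]` (as the number field `E` of `EndAction`), so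
`√-d` is the explicit parameter `α`. The determinant of a Hermitian matrix is `σ`-fixed, hence in
`ℚ`; the definition does not presuppose it (junk class `1` off `ℚ^×`). Not here: signature,
non-degeneracy, isogeny invariance and the bridge to `H¹(A(ℂ), ℚ)` of `Motives/AbelianVariety`;
the identification `normUnitsSubgroup ℚ ℚ(√-d) = {x² + d y² ≠ 0}`
(`Literature.NumberTheory.QuadraticForms.quadraticNormSubgroup ℚ (-d)`; not imported, to keep the
Hodge-theory files free of its adelic imports).

## References

* B. van Geemen, *An introduction to the Hodge conjecture for abelian varieties*, in: Algebraic
  Cycles and Hodge Theory (Torino 1993), LNM 1594, Springer 1994, 233–252; 4.9, 4.14, Lemma 5.2.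
* E. Markman, *Cycles on abelian 2n-folds of Weil type from secant sheaves on abelian n-folds*,
  arXiv:2502.03415 (2025), §1.1 and Lemma 3.1.3.
-/

noncomputable section

open Module
open scoped Matrix

namespace Literature.AlgebraicGeometry.Motives

universe u

/-! ### The norm residue group `Fˣ ⧸ Nm(Kˣ)` -/

section NormResidue

variable (F K : Type*) [Field F] [Ring K] [Algebra F K]

/-- The **norm subgroup** `Nm_{K/F}(Kˣ) ≤ Fˣ`: the range of the norm `Algebra.norm F : K →* F`
(determinant of left multiplication) on units. The quotient `Fˣ ⧸ normUnitsSubgroup F K` is the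
norm residue group `F^× / Nm(K^×)` in which van Geemen's `det H` lives (van Geemen 1994, 4.14:
"the group on the right is an infinite 2-torsion group" for `K/ℚ` imaginary quadratic). [folklore] -/
def normUnitsSubgroup : Subgroup Fˣ :=
  (Units.map (Algebra.norm F (S := K) : K →* F)).range

variable {F K}

/-- Membership in `normUnitsSubgroup`: `u` is the norm of a unit of `K`. [folklore] -/
theorem mem_normUnitsSubgroup_iff {u : Fˣ} :
    u ∈ normUnitsSubgroup F K ↔ ∃ k : Kˣ, Algebra.norm F (k : K) = u := by
  simp only [normUnitsSubgroup, MonoidHom.mem_range]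
  refine ⟨fun ⟨k, hk⟩ => ⟨k, ?_⟩, fun ⟨k, hk⟩ => ⟨k, ?_⟩⟩
  · rw [← hk, Units.coe_map]
  · ext
    rw [Units.coe_map]
    exact hk

/-- The norm of a unit of `K` lies in the norm subgroup. [folklore] -/
theorem map_norm_mem_normUnitsSubgroup (k : Kˣ) :
    Units.map (Algebra.norm F (S := K) : K →* F) k ∈ normUnitsSubgroup F K :=
  ⟨k, rfl⟩

/-- `u ^ [K : F] = Nm_{K/F}(u)` is a norm; in particular squares of rationals are norms from a
quadratic field. [folklore] -/
theorem pow_finrank_mem_normUnitsSubgroup (u : Fˣ) :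
    u ^ Module.finrank F K ∈ normUnitsSubgroup F K := by
  refine mem_normUnitsSubgroup_iff.2 ⟨Units.map (algebraMap F K : F →* K) u, ?_⟩
  rw [Units.coe_map, MonoidHom.coe_coe, Algebra.norm_algebraMap, Units.val_pow_eq_pow_val]

variable (F)

open scoped Classical in
/-- The class of `δ ∈ K` in the norm residue group `Fˣ ⧸ Nm(Kˣ)`: the class of `u` if
`δ = u ∈ Fˣ` (i.e. `δ` is the image of a unit of `F`), and the junk value `1` otherwise. Used with
`δ = det Ψ` the determinant of a Hermitian matrix, which is fixed by the involution and hence lies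
in `F` (van Geemen 1994, Lemma 5.2 (3); Markman 2025, §1.1: "the determinant … is an element of
`ℚ^×` and its image in `ℚ^×/Nm(K^×)` is called the discriminant"). [folklore] -/
def normResidueClass (δ : K) : Fˣ ⧸ normUnitsSubgroup F K :=
  if h : ∃ u : Fˣ, algebraMap F K u = δ then (QuotientGroup.mk h.choose : Fˣ ⧸ normUnitsSubgroup F K)
  else 1

/-- Off the image of `Fˣ` the class is the junk value `1`. [folklore] -/
theorem normResidueClass_of_not_exists {δ : K} (h : ¬∃ u : Fˣ, algebraMap F K u = δ) :
    normResidueClass F δ = 1 := by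
  rw [normResidueClass, dif_neg h]

variable [Nontrivial K]

/-- The class of (the image of) `u ∈ Fˣ` is `u · Nm(Kˣ)`. [folklore] -/
theorem normResidueClass_algebraMap (u : Fˣ) :
    normResidueClass F (algebraMap F K u) =
      (QuotientGroup.mk u : Fˣ ⧸ normUnitsSubgroup F K) := by
  have h : ∃ u' : Fˣ, algebraMap F K u' = algebraMap F K u := ⟨u, rfl⟩
  rw [normResidueClass, dif_pos h]
  congr 1
  exact Units.ext ((algebraMap F K).injective h.choose_spec)

end NormResidue

section NormResidueField

variable (F : Type*) {K : Type*} [Field F] [Field K] [Algebra F K]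

/-- Multiplying by a norm `Nm(k)`, `k ∈ Kˣ`, does not change the norm residue class. [folklore] -/
theorem normResidueClass_norm_mul (k : Kˣ) (δ : K) :
    normResidueClass F (algebraMap F K (Algebra.norm F (k : K)) * δ) = normResidueClass F δ := by
  set a : Fˣ := Units.map (Algebra.norm F (S := K) : K →* F) k with ha
  have hak : (a : F) = Algebra.norm F (k : K) := by rw [ha, Units.coe_map]
  have ha0 : algebraMap F K a ≠ 0 := by
    rw [Ne, map_eq_zero_iff _ (algebraMap F K).injective]
    exact a.ne_zero
  by_cases h : ∃ u : Fˣ, algebraMap F K u = δ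
  · obtain ⟨u, rfl⟩ := h
    rw [← hak, ← map_mul, ← Units.val_mul, normResidueClass_algebraMap,
      normResidueClass_algebraMap, mul_comm]
    exact QuotientGroup.mk_mul_of_mem u (map_norm_mem_normUnitsSubgroup k)
  · have h' : ¬∃ u : Fˣ, algebraMap F K u = algebraMap F K (Algebra.norm F (k : K)) * δ := by
      rintro ⟨u, hu⟩
      refine h ⟨a⁻¹ * u, ?_⟩
      rw [Units.val_mul, map_mul, hu, ← hak, Units.val_inv_eq_inv_val, map_inv₀,
        inv_mul_cancel_left₀ ha0]
    rw [normResidueClass_of_not_exists F h, normResidueClass_of_not_exists F h']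

end NormResidueField

/-! ### Gram determinants of `K`-valued forms and their norm residue class -/

section Gram

variable {K V ι : Type*}

/-- The Gram matrix `(B(vᵢ, vⱼ))ᵢⱼ` of a `K`-valued form `B` on a family `v` (for a bundled
sesquilinear form and a basis this is Mathlib's `LinearMap.toMatrix₂`, see
`gramMatrix_eq_toMatrix₂`). [folklore] -/
def gramMatrix (B : V → V → K) (v : ι → V) : Matrix ι ι K :=
  Matrix.of fun i j => B (v i) (v j)

/-- Entries of the Gram matrix. [folklore] -/
@[simp]
theorem gramMatrix_apply (B : V → V → K) (v : ι → V) (i j : ι) :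
    gramMatrix B v i j = B (v i) (v j) := rfl

end Gram

section Discr

variable (F : Type*) {K V : Type*} [Field F] [Field K] [Algebra F K] [AddCommGroup V] [Module K V]

/-- For a bundled sesquilinear form and a basis, `gramMatrix` is `LinearMap.toMatrix₂`. [folklore] -/
theorem gramMatrix_eq_toMatrix₂ {ι : Type*} [Fintype ι] [DecidableEq ι] {σ : K →+* K}
    (B : V →ₛₗ[σ] V →ₗ[K] K) (b : Basis ι K V) :
    gramMatrix (fun x y => B x y) b = LinearMap.toMatrix₂ b b B := by
  ext i j
  rw [gramMatrix_apply, LinearMap.toMatrix₂_apply]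

/-- The **discriminant class** of a `K`-valued form `B` on a finite-dimensional `K`-vector space
`V`, relative to the subfield `F`: the class in `Fˣ ⧸ Nm_{K/F}(Kˣ)` of the Gram determinant
`det (B(bᵢ, bⱼ))` in the `K`-basis `b = Module.finBasis K V` (junk class `1` if this determinant
is not in `Fˣ`). For a `σ`-sesquilinear (e.g. Hermitian) form it is independent of the basis
(`discrClass_eq_of_basis`): van Geemen 1994, Lemma 5.2 (3). [cite: vanGeemen1994HodgeAV, Lemma 5.2 (3)] -/
def discrClass [Module.Finite K V] (B : V → V → K) : Fˣ ⧸ normUnitsSubgroup F K :=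
  normResidueClass F (gramMatrix B ⇑(Module.finBasis K V)).det

/-- Unfolding `discrClass`. [folklore] -/
theorem discrClass_def [Module.Finite K V] (B : V → V → K) :
    discrClass F B = normResidueClass F (gramMatrix B ⇑(Module.finBasis K V)).det := rfl

variable {ι : Type*} [Fintype ι] [DecidableEq ι] {σ : K →+* K}

omit [DecidableEq ι] in
/-- **Change of basis for Gram matrices of a sesquilinear form**: if `P = (b.toMatrix c)` expresses
the basis `c` in the basis `b` (`c j = Σᵢ P i j • b i`), then `Gram_c = ᵗ(σ P) · Gram_b · P`
(van Geemen 1994, proof of Lemma 5.2: "changing the `K`-basis by `A` changes `Ψ` to `ᵗĀ Ψ A`"). [cite: vanGeemen1994HodgeAV, Lemma 5.2 (proof)] -/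
theorem gramMatrix_basis_eq_mul (B : V →ₛₗ[σ] V →ₗ[K] K) (b c : Basis ι K V) :
    gramMatrix (fun x y => B x y) c =
      ((b.toMatrix c).map σ)ᵀ * gramMatrix (fun x y => B x y) b * b.toMatrix c := by
  ext j l
  have hc : ∀ j, c j = ∑ i, b.toMatrix c i j • b i := fun j => by
    simp_rw [Basis.toMatrix_apply, b.sum_repr]
  simp only [gramMatrix_apply, Matrix.mul_apply, Matrix.transpose_apply, Matrix.map_apply]
  conv_lhs => rw [hc j, hc l]
  simp only [map_sum, LinearMap.sum_apply, map_smulₛₗ, LinearMap.smul_apply,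
    RingHom.id_apply, smul_eq_mul, Finset.mul_sum, Finset.sum_mul]
  refine Finset.sum_congr rfl fun l' _ => Finset.sum_congr rfl fun i _ => ?_
  ring

/-- `det Gram_c = σ(det P) · det P · det Gram_b` for `P = b.toMatrix c`
(van Geemen 1994, proof of Lemma 5.2: "`det Ψ` changes to `Nm(a) · det Ψ` where `a = det A`"). [cite: vanGeemen1994HodgeAV, Lemma 5.2 (proof)] -/
theorem det_gramMatrix_basis (B : V →ₛₗ[σ] V →ₗ[K] K) (b c : Basis ι K V) :
    (gramMatrix (fun x y => B x y) c).det =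
      σ (b.toMatrix c).det * (b.toMatrix c).det * (gramMatrix (fun x y => B x y) b).det := by
  rw [gramMatrix_basis_eq_mul B b c, Matrix.det_mul, Matrix.det_mul, Matrix.det_transpose,
    ← RingHom.mapMatrix_apply, ← RingHom.map_det]
  ring

/-- **Basis independence of the discriminant class** (van Geemen 1994, Lemma 5.2 (3)): for a
`σ`-sesquilinear form with `k · σ(k) = Nm_{K/F}(k)` (e.g. `σ` = complex conjugation on a CM or
imaginary quadratic field `K`, `F` its maximal real subfield), the Gram determinants in two
`K`-bases have the same class in `Fˣ ⧸ Nm(Kˣ)`, since they differ by the norm `Nm(det P)` of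
the (invertible) change-of-basis determinant. [cite: vanGeemen1994HodgeAV, Lemma 5.2 (3)] -/
theorem normResidueClass_det_gramMatrix_eq
    (hσ : ∀ k : K, k * σ k = algebraMap F K (Algebra.norm F k))
    (B : V →ₛₗ[σ] V →ₗ[K] K) (b c : Basis ι K V) :
    normResidueClass F (gramMatrix (fun x y => B x y) c).det =
      normResidueClass F (gramMatrix (fun x y => B x y) b).det := by
  have hu : IsUnit (b.toMatrix c).det := by
    refine IsUnit.of_mul_eq_one (c.toMatrix b).det ?_
    rw [← Matrix.det_mul, b.toMatrix_mul_toMatrix_flip c, Matrix.det_one]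
  obtain ⟨u, hu⟩ := hu
  rw [det_gramMatrix_basis B b c, ← hu, mul_comm (σ _), hσ]
  exact normResidueClass_norm_mul F u _

/-- The discriminant class of a `σ`-sesquilinear form (`k · σ(k) = Nm_{K/F}(k)`) may be computed in
ANY finite `K`-basis `c` of `V` (van Geemen 1994, Lemma 5.2 (3): "does not depend on the choice
of the `K`-basis"). [cite: vanGeemen1994HodgeAV, Lemma 5.2 (3)] -/
theorem discrClass_eq_of_basis [Module.Finite K V]
    (hσ : ∀ k : K, k * σ k = algebraMap F K (Algebra.norm F k))
    (B : V →ₛₗ[σ] V →ₗ[K] K) {ι' : Type*} [Fintype ι'] [DecidableEq ι'] (c : Basis ι' K V) :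
    discrClass F (fun x y => B x y) = normResidueClass F (gramMatrix (fun x y => B x y) c).det := by
  let e : ι' ≃ Fin (Module.finrank K V) :=
    Fintype.equivFinOfCardEq (Module.finrank_eq_card_basis c).symm
  have h1 : gramMatrix (fun x y => B x y) ⇑(c.reindex e) =
      (gramMatrix (fun x y => B x y) c).submatrix e.symm e.symm := by
    ext i j
    simp
  rw [discrClass_def, normResidueClass_det_gramMatrix_eq F hσ B (c.reindex e) (Module.finBasis K V),
    h1, Matrix.det_submatrix_equiv_self]

end Discr

/-! ### Van Geemen's Hermitian form and the discriminant of a Weil-type polarization -/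

section Weil

variable {K : Type*} [Field K] [Algebra ℚ K] {V : Type u} [AddCommGroup V] [Module ℚ V]
  [Module K V]

/-- **Van Geemen's Hermitian form** attached to a `ℚ`-bilinear form `E` on a `K`-vector space `V`
and an element `α ∈ K` (`K = ℚ(√-d)`, `α = √-d`, `V = H₁(X, ℚ)`, `E` the polarization):
`H(x, y) := E(x, α · y) + α · E(x, y) ∈ K` (van Geemen 1994, Lemma 5.2 (2)). It is `K`-linear in
the second variable (`weilHermitianForm_smul_right`) and Hermitian (`weilHermitianForm_swap`) when
`α² = -d`, `E` is alternating and `E(α x, α y) = d E(x, y)`. Defined for all inputs. [cite: vanGeemen1994HodgeAV, Lemma 5.2 (2)] -/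
def weilHermitianForm (E : LinearMap.BilinForm ℚ V) (α : K) : V → V → K :=
  fun x y => algebraMap ℚ K (E x (α • y)) + α * algebraMap ℚ K (E x y)

/-- The defining formula `H(x, y) = E(x, α · y) + α · E(x, y)`. [cite: vanGeemen1994HodgeAV, Lemma 5.2 (2)] -/
theorem weilHermitianForm_apply (E : LinearMap.BilinForm ℚ V) (α : K) (x y : V) :
    weilHermitianForm E α x y = algebraMap ℚ K (E x (α • y)) + α * algebraMap ℚ K (E x y) := rfl

/-- **The discriminant `det H ∈ ℚ^× / Nm(K^×)`** of `(V, K, E, α = √-d)`: the norm residue class of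
the determinant of the matrix `Ψ = (H(bᵢ, bⱼ))` of van Geemen's Hermitian form
`H = weilHermitianForm E α` in a `K`-basis of `V` (van Geemen 1994, Lemma 5.2 (3) and 4.14;
Markman 2025, §1.1: "its image in `ℚ^×/Nm(K^×)` is called the discriminant"). The basis used is
`Module.finBasis K V`; independence of the basis for sesquilinear `H` is `discrClass_eq_of_basis`.
Junk class `1` when `det Ψ ∉ ℚ^×`. [cite: vanGeemen1994HodgeAV, Lemma 5.2 (3)] -/
def weilDiscriminant [Module.Finite K V] (E : LinearMap.BilinForm ℚ V) (α : K) :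
    ℚˣ ⧸ normUnitsSubgroup ℚ K :=
  discrClass ℚ (weilHermitianForm E α)

/-- Unfolding `weilDiscriminant`. [folklore] -/
theorem weilDiscriminant_def [Module.Finite K V] (E : LinearMap.BilinForm ℚ V) (α : K) :
    weilDiscriminant E α =
      normResidueClass ℚ (gramMatrix (weilHermitianForm E α) ⇑(Module.finBasis K V)).det := rfl

variable [IsScalarTower ℚ K V]

/-- Rescaling the generator: `H_{c α} = c · H_α` for `c ∈ ℚ` (so `det H` changes by `c^{dim_K V}`,
a norm when `dim_K V` is even: the class does not depend on the choice of `√-d` up to `ℚ^×`). [folklore] -/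
theorem weilHermitianForm_smul (E : LinearMap.BilinForm ℚ V) (c : ℚ) (α : K) (x y : V) :
    weilHermitianForm E (c • α) x y = algebraMap ℚ K c * weilHermitianForm E α x y := by
  rw [weilHermitianForm_apply, weilHermitianForm_apply, smul_assoc, LinearMap.map_smul,
    smul_eq_mul, map_mul, Algebra.smul_def]
  ring

/-- **Independence of the normalisation of `√-d`**: for `c ∈ ℚ^×`,
`det H_{cα} = c^{dim_K V} · det H_α` (`weilHermitianForm_smul`, `Matrix.det_smul`), and
`c^{dim_K V} = Nm_{K/ℚ}(c^{dim_K V / 2})` is a norm when `dim_K V` is even and `[K : ℚ] = 2`; so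
the discriminant only depends on `(V, K, E)` and the line `ℚ^× · α` (for `K` imaginary quadratic:
on `K` and its orientation-free purely imaginary direction). [folklore] -/
theorem weilDiscriminant_smul [Module.Finite K V] (hK : Module.finrank ℚ K = 2)
    (hV : Even (Module.finrank K V)) (E : LinearMap.BilinForm ℚ V) {c : ℚ} (hc : c ≠ 0) (α : K) :
    weilDiscriminant E (c • α) = weilDiscriminant E α := by
  obtain ⟨k, hk⟩ := hV
  have hgram : gramMatrix (weilHermitianForm E (c • α)) ⇑(Module.finBasis K V) =
      algebraMap ℚ K c • gramMatrix (weilHermitianForm E α) ⇑(Module.finBasis K V) := by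
    ext i j
    simp only [gramMatrix_apply, Matrix.smul_apply, smul_eq_mul, weilHermitianForm_smul]
  set t : Kˣ := Units.map (algebraMap ℚ K : ℚ →* K) (Units.mk0 (c ^ k) (pow_ne_zero _ hc))
    with ht
  have hnorm : algebraMap ℚ K (Algebra.norm ℚ (t : K)) =
      algebraMap ℚ K c ^ Module.finrank K V := by
    rw [ht, Units.coe_map, MonoidHom.coe_coe, Units.val_mk0, Algebra.norm_algebraMap, hK, hk,
      ← pow_mul, map_pow, mul_two]
  rw [weilDiscriminant_def, weilDiscriminant_def, hgram, Matrix.det_smul, Fintype.card_fin,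
    ← hnorm, normResidueClass_norm_mul]

/-- `H` is `K`-linear in the second variable for the generator: `H(x, α y) = α H(x, y)` when
`α² = a ∈ ℚ` (van Geemen 1994, Lemma 5.2 (2): "`H` is `K`-linear in the second factor"). [cite: vanGeemen1994HodgeAV, Lemma 5.2 (2)] -/
theorem weilHermitianForm_smul_right (E : LinearMap.BilinForm ℚ V) {α : K} {a : ℚ}
    (hα : α * α = algebraMap ℚ K a) (x y : V) :
    weilHermitianForm E α x (α • y) = α * weilHermitianForm E α x y := by
  have h2 : α • α • y = a • y := by
    rw [← mul_smul, hα, algebraMap_smul]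
  simp only [weilHermitianForm_apply, h2, map_smul, smul_eq_mul, map_mul]
  linear_combination (-(algebraMap ℚ K (E x y))) * hα

/-- From `(√-d)^* E = d E` (`E(α x, α y) = d E(x, y)`, `α² = -d ≠ 0`): `E(α x, y) = -E(x, α y)`,
i.e. `α` is skew for `E` (its Rosati conjugate is `ᾱ = -α`). [folklore] -/
theorem apply_smul_left_of_weil (E : LinearMap.BilinForm ℚ V) {α : K} {d : ℚ} (hd : d ≠ 0)
    (hα : α * α = algebraMap ℚ K (-d)) (hW : ∀ x y : V, E (α • x) (α • y) = d * E x y)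
    (x y : V) : E (α • x) y = -E x (α • y) := by
  have hy : y = α • ((-d)⁻¹ • α • y) := by
    rw [smul_comm, ← mul_smul, hα, algebraMap_smul, smul_smul, inv_mul_cancel₀ (neg_ne_zero.2 hd),
      one_smul]
  conv_lhs => rw [hy, hW]
  rw [map_smul, smul_eq_mul, ← mul_assoc,
    show d * (-d)⁻¹ = -1 by rw [inv_neg, mul_neg, mul_inv_cancel₀ hd], neg_one_mul]

/-- **`H` is Hermitian** (van Geemen 1994, Lemma 5.2 (2): "`H(y, x) = conj H(x, y)`, an easy
computation using `E((√-d) x, (√-d) y) = d E(x, y)`"): for `E` alternating, `α² = -d ≠ 0` and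
`E(α x, α y) = d E(x, y)`, `H(y, x) = E(x, α y) - α E(x, y)`, the conjugate `a - b α` of
`H(x, y) = a + b α` (`a, b ∈ ℚ`). [cite: vanGeemen1994HodgeAV, Lemma 5.2 (2)] -/
theorem weilHermitianForm_swap (E : LinearMap.BilinForm ℚ V) {α : K} {d : ℚ} (hd : d ≠ 0)
    (hα : α * α = algebraMap ℚ K (-d)) (hE : ∀ x y : V, E y x = -E x y)
    (hW : ∀ x y : V, E (α • x) (α • y) = d * E x y) (x y : V) :
    weilHermitianForm E α y x = algebraMap ℚ K (E x (α • y)) - α * algebraMap ℚ K (E x y) := by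
  rw [weilHermitianForm_apply, hE (α • x) y, apply_smul_left_of_weil E hd hα hW, hE x y]
  simp only [map_neg, neg_neg]
  ring

end Weil

/-! ### The discriminant of a polarized Hodge structure with a number-field action -/

namespace HodgeStructure.EndAction

variable {V : Type u} [AddCommGroup V] [Module ℚ V] {E : Type*} [Field E] [NumberField E]
  {H : HodgeStructure V 1}

/-- The polarization `Q` is **of Weil type** for the action `A` of `E` (a polarized abelian variety /
Hodge structure of Weil type `(X, K, E)`): `Q(k·x, k·y) = Nm_{E/ℚ}(k) · Q(x, y)` for all `k ∈ E`
(Markman 2025, §1.1: "`η(k)` maps `h` to `Nm(k) h`"; for `E = ℚ(√-d)` and `k = √-d` this is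
van Geemen 1994, 4.9: "`(√-d)^* E = d E`", and conversely that case implies the general one by
bilinearity). Equivalently the Rosati involution of `Q` induces complex conjugation on `E`. [cite: Markman2025SecantWeil, §1.1] -/
def IsWeilPolarization (A : EndAction H E) (Q : H.Polarization) : Prop :=
  ∀ (k : E) (x y : V), Q.form (A.ι k x) (A.ι k y) = Algebra.norm ℚ k * Q.form x y

/-- Van Geemen's Hermitian form `H(x, y) = Q(x, α·y) + α·Q(x, y) ∈ E` of the polarization `Q` for
the `E`-module structure `A.module` on `V` and `α ∈ E` (`α = √-d`)
(van Geemen 1994, Lemma 5.2 (2)). [cite: vanGeemen1994HodgeAV, Lemma 5.2 (2)] -/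
def weilHermitianForm (A : EndAction H E) (Q : H.Polarization) (α : E) : V → V → E :=
  letI := A.module
  Motives.weilHermitianForm Q.form α

/-- The formula `A.weilHermitianForm Q α x y = Q(x, ι(α) y) + α · Q(x, y)`. [cite: vanGeemen1994HodgeAV, Lemma 5.2 (2)] -/
theorem weilHermitianForm_apply (A : EndAction H E) (Q : H.Polarization) (α : E) (x y : V) :
    A.weilHermitianForm Q α x y =
      algebraMap ℚ E (Q.form x (A.ι α y)) + α * algebraMap ℚ E (Q.form x y) := rfl

/-- **The discriminant `det H ∈ ℚ^× / Nm(E^×)`** of the polarized `E`-Hodge structure `(H, A, Q)`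
with chosen generator `α ∈ E` (`E = ℚ(√-d)`, `α = √-d`): the norm residue class of the
determinant of van Geemen's Hermitian form `A.weilHermitianForm Q α` in an `E`-basis of `V`
(van Geemen 1994, Lemma 5.2 (3), 4.14; Markman 2025, §1.1: with `n` and `K` it indexes the
components of the moduli of `2n`-dimensional abelian varieties of Weil type up to isogeny). For
`V = H¹(X, ℚ)` of a polarized abelian variety of Weil type (`A.IsOfWeilType`,
`A.IsWeilPolarization Q`) this is the discriminant of `(X, K, E)`. [cite: vanGeemen1994HodgeAV, Lemma 5.2 (3)] -/
def weilDiscriminant [FiniteDimensional ℚ V] (A : EndAction H E) (Q : H.Polarization) (α : E) :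
    ℚˣ ⧸ normUnitsSubgroup ℚ E :=
  letI := A.module
  haveI : IsScalarTower ℚ E V :=
    ⟨fun q e v => show A.ι (q • e) v = q • A.ι e v by rw [map_smul, LinearMap.smul_apply]⟩
  haveI : Module.Finite E V := Module.Finite.of_restrictScalars_finite ℚ E V
  Motives.weilDiscriminant Q.form α

/-- Unfolding: `A.weilDiscriminant Q α` is the norm residue class of the Gram determinant of
`A.weilHermitianForm Q α` in the `E`-basis `Module.finBasis E V` (for the module structure
`A.module` and the finiteness inherited from `ℚ`). [folklore] -/
theorem weilDiscriminant_eq [FiniteDimensional ℚ V] (A : EndAction H E) (Q : H.Polarization)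
    (α : E) :
    A.weilDiscriminant Q α =
      letI := A.module
      haveI : IsScalarTower ℚ E V :=
        ⟨fun q e v => show A.ι (q • e) v = q • A.ι e v by rw [map_smul, LinearMap.smul_apply]⟩
      haveI : Module.Finite E V := Module.Finite.of_restrictScalars_finite ℚ E V
      normResidueClass ℚ (gramMatrix (A.weilHermitianForm Q α) ⇑(Module.finBasis E V)).det :=
  rfl

/-- A Weil-type polarization satisfies van Geemen's `(√-d)^* E = d E` for any `α` with
`Nm(α) = d` (e.g. `α = √-d`). [cite: vanGeemen1994HodgeAV, 4.9] -/
theorem IsWeilPolarization.form_apply_apply {A : EndAction H E} {Q : H.Polarization}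
    (h : A.IsWeilPolarization Q) {α : E} {d : ℚ} (hα : Algebra.norm ℚ α = d) (x y : V) :
    Q.form (A.ι α x) (A.ι α y) = d * Q.form x y := by
  rw [h, hα]

end HodgeStructure.EndAction

end Literature.AlgebraicGeometry.Motives

end
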